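import Summits.PneNP.PneNP.Theorems.Nc03AvoidResidualCoreCandMatchRung

/-!
# Route Nc03AvoidResidualCore — the matching-class rung family is inhabited, and its honest window

Tribunal-w (bc5-witness seat), generation 4, for `route-PneNP-Nc03AvoidResidualCore`, item
`stmt-PneNP-20226` (`CandAvoidLinearFP`, C₁). T3 HYGIENE for the persisted witness
`Summit.PneNP.PneNP.Theorems.Nc03AvoidResidualCoreCandMatchRungFP.candMatch_rungFP (k) :
LocalAvoidLinearFP 3 (fun n _ I => I.IsPure candPred ∧ IsMatchingClass I ∧ headCount I ^ 3 ≤ k * n)`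
(and its explicit-avoider form `…CandMatchRung.candMatch_rung`): the rung quantifies over the family

  `𝓕ₖ = { pure CAND, matching classes, headCount³ ≤ k·n, 0 < n, (22k+1)·n ≤ m }`,

and a universally quantified rung over an EMPTY family would be vacuous. This file proves:

* **the window** (`headCount_window`): in a matching-class pure-`CAND` instance every head class has at
  most `(n−1)/2` outputs (its data pairs are disjoint and avoid the head), so `2m ≤ headCount·(n−1)`;
  at stretch `(22k+1)·n ≤ m` this forces `2(22k+1) < headCount`, and with `headCount³ ≤ k·n` it forces
  `(44k+3)³ ≤ k·n` (`window_forces_large_n`). So `𝓕ₖ` is empty for `k = 0` and for `n < (44k+3)³/k`,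
  and the rung's regime is EXACTLY the window `44k+3 ≤ headCount ≤ (k·n)^{1/3}` — stated here so that
  nobody reads the rung as covering bounded-size classes (`headCount ≍ n`), which stay the open core;
* **inhabitedness** (`fam_mem_family`, `family_cofinal`): for every `k ≥ 1` the explicit instances
  `fam (44k+4) t` — `44k+4` head variables, every class the same perfect matching on `2t` fresh data
  variables, `n = 44k+4+2t`, `m = (44k+4)·t` — lie in `𝓕ₖ` for every `t ≥ (44k+4)³`; hence `𝓕ₖ`
  contains instances with arbitrarily large `n`, and the rung's avoider provably fires on them
  (`rung_fires`, an instance of `candMatch_rung`).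

Nothing here is an algorithmic claim beyond the landed rung; it does not touch `Nc03AvoidLinearFP`,
general `NC⁰₃-AVOID`, or `P` versus `NP`. Restricted-model rung bookkeeping only.
-/

set_option linter.dupNamespace false -- `Summit.PneNP.PneNP.…`: summit = sub-problem name (D-0017 single-conjunct layout)

namespace Summit.PneNP.PneNP.Theorems.Nc03AvoidResidualCoreCandMatchRungFamily

open Finset
open Literature.Computability.Complexity
open Summit.PneNP.PneNP.Theorems.Nc03AvoidResidualCoreCandFewHeadsRung
open Summit.PneNP.PneNP.Theorems.Nc03AvoidResidualCoreCandMatchRung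

variable {n m : ℕ}

/-! ## The window: class sizes, `2m ≤ headCount·(n−1)`, and what the rung's side condition forces -/

/-- The head class of `c`: the outputs whose head (argument role `0`) is `c`. -/
def headClass (I : LocalMap 3 n m) (c : Fin n) : Finset (Fin m) := univ.filter fun j => I.vars j 0 = c

/-- In a matching-class pure-`CAND` instance a head class has at most `(n−1)/2` outputs: its data pairs
are pairwise disjoint `2`-sets avoiding the head variable. -/
theorem two_mul_card_headClass_le {I : LocalMap 3 n m} (hI : I.IsPure candPred)
    (hM : IsMatchingClass I) (c : Fin n) : 2 * #(headClass I c) ≤ n - 1 := by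
  classical
  have hdisj : ((headClass I c : Set (Fin m))).PairwiseDisjoint (pset I) := by
    intro j hj j' hj' hne
    rw [Function.onFun, Finset.disjoint_left]
    intro v hv hv'
    have hj0 : I.vars j 0 = c := (Finset.mem_filter.mp hj).2
    have hj'0 : I.vars j' 0 = c := (Finset.mem_filter.mp hj').2
    simp only [pset, Finset.mem_insert, Finset.mem_singleton] at hv hv'
    have key := hM j j' hne (hj0.trans hj'0.symm)
    rcases hv with rfl | rfl <;> rcases hv' with h | h
    · exact key 1 1 (by decide) (by decide) h
    · exact key 1 2 (by decide) (by decide) h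
    · exact key 2 1 (by decide) (by decide) h
    · exact key 2 2 (by decide) (by decide) h
  have hcard : #((headClass I c).biUnion (pset I)) = 2 * #(headClass I c) := by
    rw [Finset.card_biUnion hdisj, Finset.sum_const_nat (m := 2) fun j _ => pset_card hI j, mul_comm]
  have hsub : (headClass I c).biUnion (pset I) ⊆ univ.erase c := by
    intro v hv
    rw [Finset.mem_biUnion] at hv
    obtain ⟨j, hj, hv⟩ := hv
    have hj0 : I.vars j 0 = c := (Finset.mem_filter.mp hj).2
    rw [Finset.mem_erase]
    refine ⟨?_, Finset.mem_univ _⟩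
    simp only [pset, Finset.mem_insert, Finset.mem_singleton] at hv
    rcases hv with rfl | rfl
    · intro h
      exact absurd (hI.2 j (h.trans hj0.symm)) (by decide)
    · intro h
      exact absurd (hI.2 j (h.trans hj0.symm)) (by decide)
  have := Finset.card_le_card hsub
  rw [hcard, Finset.card_erase_of_mem (Finset.mem_univ c), Finset.card_univ, Fintype.card_fin] at this
  exact this

/-- Hence `2m ≤ headCount · (n − 1)` for matching-class pure-`CAND` instances. -/
theorem two_mul_le_headCount_mul {I : LocalMap 3 n m} (hI : I.IsPure candPred)
    (hM : IsMatchingClass I) : 2 * m ≤ headCount I * (n - 1) := by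
  classical
  have h := Finset.card_le_mul_card_image (univ : Finset (Fin m)) ((n - 1) / 2)
    (f := fun j => I.vars j 0) (fun c _ => by
      have := two_mul_card_headClass_le hI hM c
      have hle : #({a ∈ (univ : Finset (Fin m)) | I.vars a 0 = c}) ≤ (n - 1) / 2 := by
        rw [Nat.le_div_iff_mul_le (by norm_num)]
        simpa [headClass, mul_comm] using this
      exact hle)
  rw [Finset.card_univ, Fintype.card_fin] at h
  have h2 : 2 * ((n - 1) / 2) ≤ n - 1 := Nat.mul_div_le (n - 1) 2
  calc 2 * m ≤ 2 * ((n - 1) / 2 * headCount I) := Nat.mul_le_mul_left 2 h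
    _ = 2 * ((n - 1) / 2) * headCount I := by rw [headCount]; ring
    _ ≤ (n - 1) * headCount I := Nat.mul_le_mul_right _ h2
    _ = headCount I * (n - 1) := mul_comm _ _

/-- **The window.** In the rung's family the stretch forces MANY head classes: `2(22k+1) < headCount`. -/
theorem headCount_window {I : LocalMap 3 n m} (hI : I.IsPure candPred) (hM : IsMatchingClass I)
    {k : ℕ} (hn : 0 < n) (hm : (22 * k + 1) * n ≤ m) : 2 * (22 * k + 1) < headCount I := by
  have h2 := two_mul_le_headCount_mul hI hM
  by_contra hlt
  have hle : headCount I ≤ 2 * (22 * k + 1) := not_lt.mp hlt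
  have h3 : headCount I * (n - 1) ≤ 2 * (22 * k + 1) * (n - 1) := Nat.mul_le_mul_right _ hle
  have h4 : 2 * ((22 * k + 1) * n) ≤ 2 * m := Nat.mul_le_mul_left 2 hm
  have h5 : 2 * (22 * k + 1) * (n - 1) < 2 * ((22 * k + 1) * n) := by
    have : n - 1 < n := Nat.sub_lt hn Nat.one_pos
    have hpos : 0 < 2 * (22 * k + 1) := by positivity
    calc 2 * (22 * k + 1) * (n - 1) < 2 * (22 * k + 1) * n := Nat.mul_lt_mul_of_pos_left this hpos
      _ = 2 * ((22 * k + 1) * n) := by ring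
  omega

/-- … and together with `headCount³ ≤ k·n` the side condition forces `(44k+3)³ ≤ k·n`: the family is
empty for `k = 0` and for all `n < (44k+3)³ / k`. -/
theorem window_forces_large_n {I : LocalMap 3 n m} (hI : I.IsPure candPred) (hM : IsMatchingClass I)
    {k : ℕ} (hk : headCount I ^ 3 ≤ k * n) (hn : 0 < n) (hm : (22 * k + 1) * n ≤ m) :
    (44 * k + 3) ^ 3 ≤ k * n := by
  have hw := headCount_window hI hM hn hm
  have : 44 * k + 3 ≤ headCount I := by omega
  calc (44 * k + 3) ^ 3 ≤ headCount I ^ 3 := Nat.pow_le_pow_left this 3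
    _ ≤ k * n := hk

/-- In particular the `k = 0` member of the rung family is empty (the rung is vacuous there, honestly). -/
theorem family_empty_zero {I : LocalMap 3 n m} (hI : I.IsPure candPred) (hM : IsMatchingClass I)
    (hk : headCount I ^ 3 ≤ 0 * n) (hn : 0 < n) (hm : (22 * 0 + 1) * n ≤ m) : False := by
  have := window_forces_large_n hI hM hk hn hm
  omega

/-! ## The explicit family `fam h t`: `h` head variables, each class the same perfect matching on `2t` data variables -/

/-- The three positions of output `(c, i)`: head `c < h`, data pair `(h + 2i, h + 2i + 1)`. -/
def famPos (h t : ℕ) (c : Fin h) (i : Fin t) : Fin 3 → Fin (h + 2 * t) :=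
  ![Fin.castAdd (2 * t) c, Fin.natAdd h ⟨2 * i.val, by omega⟩, Fin.natAdd h ⟨2 * i.val + 1, by omega⟩]

/-- The head position of output `(c, i)` is `c`. -/
@[simp] theorem famPos_zero_val (h t : ℕ) (c : Fin h) (i : Fin t) : (famPos h t c i 0).val = c.val := by
  simp [famPos]

/-- The first data position of output `(c, i)` is `h + 2i`. -/
@[simp] theorem famPos_one_val (h t : ℕ) (c : Fin h) (i : Fin t) :
    (famPos h t c i 1).val = h + 2 * i.val := by
  simp [famPos]

/-- The second data position of output `(c, i)` is `h + 2i + 1`. -/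
@[simp] theorem famPos_two_val (h t : ℕ) (c : Fin h) (i : Fin t) :
    (famPos h t c i 2).val = h + (2 * i.val + 1) := by
  simp [famPos]

/-- The instance `fam h t : {0,1}^{h+2t} → {0,1}^{h·t}`: output `(c, i)` (via `finProdFinEquiv`) is
`x_c ⊕ (x_{h+2i} ∧ x_{h+2i+1})`. -/
def fam (h t : ℕ) : LocalMap 3 (h + 2 * t) (h * t) where
  vars j := famPos h t (finProdFinEquiv.symm j).1 (finProdFinEquiv.symm j).2
  table _ := candPred

/-- Unfolding lemma for the positions of `fam h t`. -/
theorem fam_vars (h t : ℕ) (j : Fin (h * t)) :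
    (fam h t).vars j = famPos h t (finProdFinEquiv.symm j).1 (finProdFinEquiv.symm j).2 := rfl

/-- `fam h t` is a pure `CAND` instance (one table, three distinct positions per output). -/
theorem fam_isPure (h t : ℕ) : (fam h t).IsPure candPred := by
  refine ⟨fun _ => rfl, fun j => ?_⟩
  intro a b hab
  have hv := congrArg Fin.val hab
  rw [fam_vars] at hv
  set c := (finProdFinEquiv.symm j).1
  set i := (finProdFinEquiv.symm j).2
  have hc := c.isLt
  fin_cases a <;> fin_cases b
  all_goals first
    | rfl
    | (exfalso
       simp only [Fin.zero_eta, Fin.mk_one, Fin.reduceFinMk, famPos_zero_val, famPos_one_val,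
         famPos_two_val] at hv
       omega)

/-- `fam h t` has matching classes: two distinct outputs with the same head have disjoint data pairs. -/
theorem fam_isMatchingClass (h t : ℕ) : IsMatchingClass (fam h t) := by
  intro j j' hne hhead a b ha hb
  have hv := congrArg Fin.val hhead
  rw [fam_vars, fam_vars, famPos_zero_val, famPos_zero_val] at hv
  have hc : (finProdFinEquiv.symm j).1 = (finProdFinEquiv.symm j').1 := Fin.ext hv
  have hi : (finProdFinEquiv.symm j).2 ≠ (finProdFinEquiv.symm j').2 := by
    intro hi
    apply hne
    have : finProdFinEquiv.symm j = finProdFinEquiv.symm j' := Prod.ext hc hi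
    exact finProdFinEquiv.symm.injective this
  have hi' : (finProdFinEquiv.symm j).2.val ≠ (finProdFinEquiv.symm j').2.val :=
    fun h' => hi (Fin.ext h')
  intro hEq
  have hv2 := congrArg Fin.val hEq
  rw [fam_vars, fam_vars] at hv2
  fin_cases a <;> fin_cases b
  all_goals first
    | exact absurd rfl ha
    | exact absurd rfl hb
    | (simp only [Fin.mk_one, Fin.reduceFinMk, famPos_one_val, famPos_two_val] at hv2
       omega)

/-- `fam h t` uses at most `h` head variables. -/
theorem headCount_fam_le (h t : ℕ) : headCount (fam h t) ≤ h := by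
  classical
  have hsub : (univ.image fun j => (fam h t).vars j 0) ⊆
      (univ : Finset (Fin h)).image (Fin.castAdd (2 * t)) := by
    intro v hv
    rw [Finset.mem_image] at hv ⊢
    obtain ⟨j, -, rfl⟩ := hv
    exact ⟨(finProdFinEquiv.symm j).1, Finset.mem_univ _, by rw [fam_vars]; rfl⟩
  calc headCount (fam h t) = #(univ.image fun j => (fam h t).vars j 0) := rfl
    _ ≤ #((univ : Finset (Fin h)).image (Fin.castAdd (2 * t))) := Finset.card_le_card hsub
    _ ≤ #(univ : Finset (Fin h)) := Finset.card_image_le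
    _ = h := by rw [Finset.card_univ, Fintype.card_fin]

/-! ## Membership in the rung family and cofinality -/

/-- **Inhabitedness.** For every `k ≥ 1` and every `t ≥ (44k+4)³`, the instance `fam (44k+4) t`
(`n = 44k+4+2t`, `m = (44k+4)·t`) satisfies the full side condition of `candMatch_rung k` /
`candMatch_rungFP k`: pure `CAND`, matching classes, `headCount³ ≤ k·n`, `0 < n`, `(22k+1)·n ≤ m`. -/
theorem fam_mem_family (k t : ℕ) (hk : 1 ≤ k) (ht : (44 * k + 4) ^ 3 ≤ t) :
    ((fam (44 * k + 4) t).IsPure candPred ∧ IsMatchingClass (fam (44 * k + 4) t) ∧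
        headCount (fam (44 * k + 4) t) ^ 3 ≤ k * (44 * k + 4 + 2 * t)) ∧
      0 < 44 * k + 4 + 2 * t ∧ (22 * k + 1) * (44 * k + 4 + 2 * t) ≤ (44 * k + 4) * t := by
  refine ⟨⟨fam_isPure _ _, fam_isMatchingClass _ _, ?_⟩, by omega, ?_⟩
  · have h1 : headCount (fam (44 * k + 4) t) ^ 3 ≤ (44 * k + 4) ^ 3 :=
      Nat.pow_le_pow_left (headCount_fam_le _ _) 3
    have h2 : t ≤ k * (44 * k + 4 + 2 * t) := by
      calc t ≤ 44 * k + 4 + 2 * t := by omega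
        _ = 1 * (44 * k + 4 + 2 * t) := (one_mul _).symm
        _ ≤ k * (44 * k + 4 + 2 * t) := Nat.mul_le_mul_right _ hk
    exact h1.trans (ht.trans h2)
  · have hsq : (22 * k + 1) * (44 * k + 4) ≤ t := by
      calc (22 * k + 1) * (44 * k + 4) ≤ (44 * k + 4) * (44 * k + 4) :=
            Nat.mul_le_mul_right _ (by omega)
        _ ≤ (44 * k + 4) * (44 * k + 4) * (44 * k + 4) := Nat.le_mul_of_pos_right _ (by omega)
        _ = (44 * k + 4) ^ 3 := by ring
        _ ≤ t := ht
    have hlin : (44 * k + 2) * t + t ≤ (44 * k + 4) * t := by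
      have : (44 * k + 2) * t + t = (44 * k + 3) * t := by ring
      rw [this]
      exact Nat.mul_le_mul_right t (by omega)
    calc (22 * k + 1) * (44 * k + 4 + 2 * t) = (22 * k + 1) * (44 * k + 4) + (44 * k + 2) * t := by ring
      _ ≤ t + (44 * k + 2) * t := Nat.add_le_add_right hsq _
      _ = (44 * k + 2) * t + t := add_comm _ _
      _ ≤ (44 * k + 4) * t := hlin

/-- **Cofinality.** For every `k ≥ 1` the rung family contains instances with arbitrarily large `n`
(so `candMatch_rungFP k` is a statement about an infinite family of instances, not a vacuous one). -/
theorem family_cofinal (k : ℕ) (hk : 1 ≤ k) (N : ℕ) :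
    ∃ n, N ≤ n ∧ ∃ m, ∃ I : LocalMap 3 n m,
      (I.IsPure candPred ∧ IsMatchingClass I ∧ headCount I ^ 3 ≤ k * n) ∧ 0 < n ∧
        (22 * k + 1) * n ≤ m := by
  refine ⟨44 * k + 4 + 2 * max ((44 * k + 4) ^ 3) N, ?_, (44 * k + 4) * max ((44 * k + 4) ^ 3) N,
    fam (44 * k + 4) (max ((44 * k + 4) ^ 3) N), fam_mem_family k _ hk (le_max_left _ _)⟩
  have := le_max_right ((44 * k + 4) ^ 3) N
  omega

/-- The rung's explicit avoider fires on the explicit family (an instance of `candMatch_rung`): for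
`k ≥ 1` and `t ≥ (44k+4)³`, `candMatchAvoid (fam (44k+4) t)` lies outside the range. -/
theorem rung_fires (k t : ℕ) (hk : 1 ≤ k) (ht : (44 * k + 4) ^ 3 ≤ t) :
    candMatchAvoid (fam (44 * k + 4) t) ∉ (fam (44 * k + 4) t).range := by
  obtain ⟨hQ, hn, hm⟩ := fam_mem_family k t hk ht
  exact candMatch_rung k _ _ _ hQ hn hm

end Summit.PneNP.PneNP.Theorems.Nc03AvoidResidualCoreCandMatchRungFamily
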